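import Literature.NumberTheory.Rogawski1990.KottwitzSignProductFormula
import Literature.NumberTheory.Rogawski1990.SingularObstructionIndicator
import Literature.NumberTheory.GaloisRepresentations.QuadraticIdeleNormResidueExact
import HarnessLib

/-!
# Kottwitz's sign IS the endoscopic character on the self-carrier: `e_𝐀(q) = (−1)^{obs_s(q)}` on `𝒞′_𝐀(γ₀)` — the ASSEMBLY
# from the local flips (Rogawski 1990, §4.1 (4.1.2) pp. 39–40, §5.4 (5.4.2)–(5.4.3) pp. 72–73; Kottwitz 1983; Kottwitz 1986 §9)

Topic `NumberTheory/Rogawski1990`; namespace `Literature.NumberTheory.Rogawski1990`. THEOREMS ONLY over accepted tree modules: no definition,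
no named fact, no instance, no notation, no `sorry`. Cell `pub/hodgecm-mathlib`, ENGINE T1 (crux H413 = `stmt-HodgeConjecture-24833`), O7 row
**(d) «THE SIGN WEIGHT READS THE OBSTRUCTION»** (O7 OWNER WORDS #41∕#43; A-p17 (g16)'s row, census 12:51:44Z; this file = its parts (1)(2)(4) + head,
typed by A-p18 (g20) over the LOCAL FLIPS (3) taken as HYPOTHESES in the census spelling — they are A-p17's `KottwitzSignLocalFlip` theorems).

THE MATHEMATICS.  For a rational split-singular non-central `γ₀ ∈ U(H)(L⁺)` and `q` in its adelic stable class `𝒞′_𝐀(γ₀)` with adelic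
conjugator `g` and descended block-determinant idèle `W ∈ 𝕀_{L⁺}` (`con W = blockDet (e ⊗ 1) x_g`, ★ `exists_ideleBaseChange_eq_adelicBlockDet`):
* (3) LOCAL FLIPS (hypotheses `hfin`, `harch`): `e_v(q_v) = −1 ↔ (e_v((γ₀)_v) = −1 ↔ W_v ∈ N(L_w^×))` at every finite `v`, and the same at every
  complex place `W` of `L` over the real place `W|_{L⁺}` — i.e. `e_v(q_v) = e_v((γ₀)_v) · χ_v(W_v)` with `χ_v` the local norm-residue character of `L∕L⁺`;
* (2) BASE POINT ★ `kottwitzSignAdelic_toAdelic_eq_one` (W19-4, Hilbert reciprocity): `e_𝐀(γ₀ ⊗ 1) = 1` — used as a BLACK BOX;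
* (4) ASSEMBLY: `e_𝐀(q) = e_∞(q) ∏ᶠ_v e_v(q_v) = [e_∞(γ₀) ∏ᶠ_v e_v((γ₀)_v)] · [∏_{w∣∞} χ_w(W_w) ∏ᶠ_v χ_v(W_v)] = 1 · (−1)^{#{places where W is not a local norm}}
  = (−1)^{[W]_{L⁺,θ}}` (★ `quadraticArtinIndicator_eq_natCast_ncard`) `= (−1)^{obs_s(q)}` (★ `MatchingAdeleG₂.singularObs_eq_quadraticArtinIndicator`).
Main results: `kottwitzSignAdelic_eq_of_flip` (abstract assembly in `ℤˣ`), `kottwitzSignAdelic_adele_eq_of_localFlip` ((4) over (3)),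
**`kottwitzSignWeight_eq_of_singularObs_of_localFlip`** (A-p16 (g21)'s `SignWeightReadsObs (kottwitzSignWeight L 3 H)` text :371 VERBATIM, modulo (3)).

## References
* [Rogawski1990] J. D. Rogawski, *Automorphic Representations of Unitary Groups in Three Variables*, Ann. of Math. Stud. 123 (1990), §3.8 Prop. 3.8.1
  p. 37; §4.1 (4.1.2) pp. 39–40; §5.4 pp. 72–73; §14.5 p. 239.
* [Kottwitz1983] R. E. Kottwitz, *Sign changes in harmonic analysis on reductive groups*, Trans. AMS 278 (1983), 289–297, §1.
* [Kottwitz1986] R. E. Kottwitz, *Stable trace formula: elliptic singular terms*, Math. Ann. 275 (1986), §9.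
* [Omeara1963] O. T. O'Meara, *Introduction to Quadratic Forms* (1963), §71 Thms. 71:18–71:19.
-/

set_option autoImplicit false

noncomputable section

open NumberField NumberField.InfinitePlace IsDedekindDomain Matrix
open scoped MatrixGroups

namespace Literature.NumberTheory.Rogawski1990

open Literature.NumberTheory.Automorphic
open Literature.NumberTheory.GaloisRepresentations (ideleGroup quadraticArtinIndicator)
open Literature.NumberTheory.QuadraticForms (quadraticNormSubgroup ideleFiniteComponent ideleInfiniteComponent)
open Literature.AlgebraicGeometry.ShimuraVarieties (unitaryGroup)

variable {L : Type} [Field L] [NumberField L] [IsCMField L] {H : Matrix (Fin 3) (Fin 3) L}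

/-! ## §1 Book-keeping: products of signs, complex places of `L` vs places of `L⁺` -/

/-- A `±1`-valued function with finite «`−1`-set» `A`: `∏ᶠ_v f v = (−1)^{#A}`. [cite: Omeara1963, §71 Thm. 71:18] -/
private theorem finprod_eq_neg_one_pow_ncard' {ι : Type*} (f : ι → ℤˣ) (A : Set ι) (hA : A.Finite) (hf : ∀ i, f i = -1 ↔ i ∈ A) :
    ∏ᶠ i, f i = (-1) ^ A.ncard := by
  classical
  have hsupp : Function.mulSupport f ⊆ hA.toFinset := by
    intro i hi
    rw [Set.Finite.coe_toFinset]
    rcases Int.units_eq_one_or (f i) with h | h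
    · exact absurd h hi
    · exact (hf i).1 h
  rw [finprod_eq_prod_of_mulSupport_subset f hsupp, Set.ncard_eq_toFinset_card A hA]
  have : ∀ i ∈ hA.toFinset, f i = -1 := fun i hi => (hf i).2 (by simpa using hi)
  rw [Finset.prod_congr rfl this, Finset.prod_const]
  rfl

/-- The «`−1`-set» of a `ℤˣ`-valued function is its multiplicative support. [cite: Omeara1963, §71 Thm. 71:18] -/
private theorem mulSupport_eq_setOf_eq_neg_one {ι : Type*} (f : ι → ℤˣ) : Function.mulSupport f = {i | f i = -1} := by
  ext i
  rw [Function.mem_mulSupport, Set.mem_setOf_eq]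
  rcases Int.units_eq_one_or (f i) with h | h
  · rw [h]; decide
  · rw [h]; decide

/-- `(−1)^n = ±1` according to the parity of `n` (in `ℤˣ`). [cite: Omeara1963, §71 Thm. 71:18] -/
private theorem neg_one_uzpow_eq_ite (n : ℕ) : ((-1 : ℤˣ) ^ n) = if Even n then 1 else -1 := by
  rcases Nat.even_or_odd n with ⟨k, rfl⟩ | ⟨k, rfl⟩
  · rw [if_pos ⟨k, rfl⟩, uzpow_add]
    exact Int.units_mul_self _
  · rw [if_neg (Nat.not_even_iff_odd.2 ⟨k, rfl⟩), uzpow_add, two_mul, uzpow_add, Int.units_mul_self, one_mul, uzpow_one]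

variable (L) in
open scoped Classical in
/-- **Restriction `W ↦ W|_{L⁺}` is a bijection from the complex places of the CM field `L` onto the places of `L⁺`** (★ `comap_surjective`, ★
`IsCMField.card_infinitePlace_eq_card_infinitePlace`, every place of `L` is complex). [cite: Rogawski1990, §3.8 Prop. 3.8.1 (d) p. 37] -/
theorem bijective_complexPlace_comap :
    Function.Bijective (fun W : {w : InfinitePlace L // IsComplex w} => W.1.comap (algebraMap (maximalRealSubfield L) L)) := by
  classical
  have hbij : Function.Bijective (fun W : InfinitePlace L => W.comap (algebraMap (maximalRealSubfield L) L)) := by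
    rw [Fintype.bijective_iff_surjective_and_card]
    exact ⟨NumberField.InfinitePlace.comap_surjective, (IsCMField.card_infinitePlace_eq_card_infinitePlace L).symm⟩
  have hval : Function.Bijective (fun W : {w : InfinitePlace L // IsComplex w} => W.1) :=
    ⟨Subtype.val_injective, fun W => ⟨⟨W, IsTotallyComplex.isComplex W⟩, rfl⟩⟩
  exact hbij.comp hval

variable (L) in
open scoped Classical in
/-- A product over the complex places of `L` of a function of the underlying place of `L⁺` is the product over the places of `L⁺`.
[cite: Rogawski1990, §3.8 Prop. 3.8.1 (d) p. 37] -/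
theorem prod_complexPlace_comap_eq {M : Type*} [CommMonoid M] (f : InfinitePlace (maximalRealSubfield L) → M) :
    ∏ W : {w : InfinitePlace L // IsComplex w}, f (W.1.comap (algebraMap (maximalRealSubfield L) L)) = ∏ w, f w :=
  Fintype.prod_bijective _ (bijective_complexPlace_comap L) _ _ fun _ => rfl

/-- A `±1`-valued function on a finite type: `∏_i f i = (−1)^{#{i : f i = −1}}`. [cite: Omeara1963, §71 Thm. 71:18] -/
private theorem prod_eq_neg_one_pow_ncard {ι : Type*} [Fintype ι] (f : ι → ℤˣ) : ∏ i, f i = (-1) ^ {i | f i = -1}.ncard := by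
  rw [← finprod_eq_prod_of_fintype]
  exact finprod_eq_neg_one_pow_ncard' f _ (Set.toFinite _) fun _ => Iff.rfl

/-! ## §2 The abstract assembly: local flips + the base-point product formula -/

open scoped Classical in
/-- **ASSEMBLY IN `ℤˣ`**: if the local signs of `g ∈ U(H)(𝔸)` are those of the base point `γ₀ ⊗ 1` TWISTED by `±1`-valued functions `χ_v` (finite
places, finitely supported) and `χ_w` (places of `L⁺`, read at `W|_{L⁺}` for the complex places `W` of `L`), then — the base point having adelic
sign `1` (★ W19-4 `kottwitzSignAdelic_toAdelic_eq_one`) — `e_𝐀(g) = ∏_w χ_w · ∏ᶠ_v χ_v`. [cite: Rogawski1990, §4.1 (4.1.2) pp. 39–40; §5.4 p. 72]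
[cite: Kottwitz1983, §1] -/
theorem kottwitzSignAdelic_eq_of_flip (hH : (H.map (cmConjRingHom L))ᵀ = H) (hdet : H.det ≠ 0)
    (γ₀ : (UnitaryGroup.cmDatum L 3 H).Rational) {α β : L} (hαβ : α ≠ β)
    (hγ : ((((γ₀ : unitaryGroup (cmConjRingHom L) H).val : GL (Fin 3) L).val : Matrix (Fin 3) (Fin 3) L) - α • 1) *
      ((((γ₀ : unitaryGroup (cmConjRingHom L) H).val : GL (Fin 3) L).val : Matrix (Fin 3) (Fin 3) L) - β • 1) = 0)
    (hα : (((γ₀ : unitaryGroup (cmConjRingHom L) H).val : GL (Fin 3) L).val : Matrix (Fin 3) (Fin 3) L) ≠ α • 1)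
    (hβ : (((γ₀ : unitaryGroup (cmConjRingHom L) H).val : GL (Fin 3) L).val : Matrix (Fin 3) (Fin 3) L) ≠ β • 1)
    (g : (UnitaryGroup.cmDatum L 3 H).Adelic) (χf : HeightOneSpectrum (𝓞 ↥(maximalRealSubfield L)) → ℤˣ)
    (χi : InfinitePlace (maximalRealSubfield L) → ℤˣ) (hχf : (Function.mulSupport χf).Finite)
    (hflipf : ∀ v, kottwitzSignLocal L 3 H v (ConjClasses.mk ((UnitaryGroup.cmDatum L 3 H).toLocal v g)) =
      kottwitzSignLocal L 3 H v (ConjClasses.mk ((UnitaryGroup.cmDatum L 3 H).toLocal v ((UnitaryGroup.cmDatum L 3 H).toAdelic γ₀))) * χf v)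
    (hflipi : ∀ W : {w : InfinitePlace L // IsComplex w},
      kottwitzSignAt L 3 H W (UnitaryGroup.archPart (↥(maximalRealSubfield L)) L (IsCMField.complexConj L) 3 H g) =
        kottwitzSignAt L 3 H W (UnitaryGroup.archPart (↥(maximalRealSubfield L)) L (IsCMField.complexConj L) 3 H ((UnitaryGroup.cmDatum L 3 H).toAdelic γ₀)) *
          χi (W.1.comap (algebraMap (maximalRealSubfield L) L))) :
    kottwitzSignAdelic L 3 H g = (∏ w, χi w) * ∏ᶠ v, χf v := by
  classical
  have hbase := kottwitzSignAdelic_toAdelic_eq_one hH hdet γ₀ hαβ hγ hα hβ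
  -- finiteness of the base point's local support
  have htfin : (Function.mulSupport fun v => kottwitzSignLocal L 3 H v
      (ConjClasses.mk ((UnitaryGroup.cmDatum L 3 H).toLocal v ((UnitaryGroup.cmDatum L 3 H).toAdelic γ₀)))).Finite := by
    have h := eventually_kottwitzSignLocal_toAdelic_eq_one hH hdet γ₀ hαβ hγ hα hβ
    rwa [Filter.eventually_cofinite] at h
  unfold kottwitzSignAdelic at hbase ⊢
  rw [kottwitzSignArch_mk] at hbase ⊢
  simp_rw [hflipf, hflipi]
  rw [Finset.prod_mul_distrib, finprod_mul_distrib htfin hχf, prod_complexPlace_comap_eq L χi, mul_mul_mul_comm, hbase, one_mul]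

/-! ## §3 (4) over (3): the adelic sign of a matching adèle reads the quadratic Artin symbol of the block-determinant idèle -/

open scoped Classical in
/-- **(4) ASSEMBLY OVER THE LOCAL FLIPS (3)**: for `q ∈ 𝒞′_𝐀(γ₀)` (`γ₀` rational split-singular non-central) and an idèle `X` of `L⁺`, IF the local
signs of `q` are those of `γ₀ ⊗ 1` twisted by the local norm-residue characters of `L∕L⁺` at `X` — at every finite place (`hfin`) and at every complex
place `W` of `L` read at `W|_{L⁺}` (`harch`); the (3) texts of A-p17 (g16)'s `KottwitzSignLocalFlip` at the descended block-determinant idèle — THEN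
`e_𝐀(q) = (−1)^{#{v ∤ ∞ : X_v ∉ N} + #{w ∣ ∞ : X_w ∉ N}}`. [cite: Rogawski1990, §4.1 (4.1.2) pp. 39–40; §5.4 (5.4.2)–(5.4.3) pp. 72–73] [cite: Kottwitz1983, §1]
[cite: Omeara1963, §71 Thm. 71:19] -/
theorem kottwitzSignAdelic_adele_eq_of_localFlip (hH : (H.map (cmConjRingHom L))ᵀ = H) (hdet : H.det ≠ 0)
    (γ₀ : (UnitaryGroup.cmDatum L 3 H).Rational) {a b : L} (hab : a ≠ b)
    (hγ₀ : ((((γ₀ : unitaryGroup (cmConjRingHom L) H).val : GL (Fin 3) L) : Matrix (Fin 3) (Fin 3) L) - a • (1 : Matrix (Fin 3) (Fin 3) L)) *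
      ((((γ₀ : unitaryGroup (cmConjRingHom L) H).val : GL (Fin 3) L) : Matrix (Fin 3) (Fin 3) L) - b • (1 : Matrix (Fin 3) (Fin 3) L)) = 0)
    (hα : (((γ₀ : unitaryGroup (cmConjRingHom L) H).val : GL (Fin 3) L) : Matrix (Fin 3) (Fin 3) L) ≠ a • 1)
    (hβ : (((γ₀ : unitaryGroup (cmConjRingHom L) H).val : GL (Fin 3) L) : Matrix (Fin 3) (Fin 3) L) ≠ b • 1)
    (q : MatchingAdeleG₂ L H H γ₀) (X : (AdeleRing (𝓞 ↥(maximalRealSubfield L)) ↥(maximalRealSubfield L))ˣ)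
    (hfin : ∀ v : HeightOneSpectrum (𝓞 ↥(maximalRealSubfield L)),
      kottwitzSignLocal L 3 H v (ConjClasses.mk ((UnitaryGroup.cmDatum L 3 H).toLocal v q.adele)) =
        kottwitzSignLocal L 3 H v (ConjClasses.mk ((UnitaryGroup.cmDatum L 3 H).toLocal v ((UnitaryGroup.cmDatum L 3 H).toAdelic γ₀))) *
          (if ideleFiniteComponent (↥(maximalRealSubfield L)) v X ∈
              quadraticNormSubgroup (v.adicCompletion ↥(maximalRealSubfield L))
                (algebraMap (↥(maximalRealSubfield L)) (v.adicCompletion ↥(maximalRealSubfield L)) (cmQuadraticGenerator L : ↥(maximalRealSubfield L)))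
            then 1 else -1))
    (harch : ∀ w : {w : InfinitePlace L // IsComplex w},
      kottwitzSignAt L 3 H w (UnitaryGroup.archPart (↥(maximalRealSubfield L)) L (IsCMField.complexConj L) 3 H q.adele) =
        kottwitzSignAt L 3 H w (cmRationalToArch L 3 H γ₀) *
          (if ideleInfiniteComponent (↥(maximalRealSubfield L)) (w.1.comap (algebraMap (↥(maximalRealSubfield L)) L)) X ∈
              quadraticNormSubgroup ((w.1.comap (algebraMap (↥(maximalRealSubfield L)) L)).Completion)
                (algebraMap (↥(maximalRealSubfield L)) _ (cmQuadraticGenerator L : ↥(maximalRealSubfield L)))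
            then 1 else -1)) :
    kottwitzSignAdelic L 3 H q.adele =
      (-1) ^ ({v : HeightOneSpectrum (𝓞 ↥(maximalRealSubfield L)) | ideleFiniteComponent (maximalRealSubfield L) v X ∉
            quadraticNormSubgroup (v.adicCompletion (maximalRealSubfield L))
              (algebraMap (maximalRealSubfield L) (v.adicCompletion (maximalRealSubfield L)) (cmQuadraticGenerator L : maximalRealSubfield L))}.ncard +
        {w : InfinitePlace (maximalRealSubfield L) | ideleInfiniteComponent (maximalRealSubfield L) w X ∉
            quadraticNormSubgroup w.Completion (algebraMap (maximalRealSubfield L) w.Completion (cmQuadraticGenerator L : maximalRealSubfield L))}.ncard) := by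
  classical
  -- the local characters `χ_v`, `χ_w`
  obtain ⟨χf, hχf⟩ : ∃ χf : HeightOneSpectrum (𝓞 ↥(maximalRealSubfield L)) → ℤˣ, ∀ v, χf v =
      if ideleFiniteComponent (maximalRealSubfield L) v X ∈ quadraticNormSubgroup (v.adicCompletion (maximalRealSubfield L))
        (algebraMap (maximalRealSubfield L) (v.adicCompletion (maximalRealSubfield L)) (cmQuadraticGenerator L : maximalRealSubfield L)) then 1 else -1 :=
    ⟨_, fun _ => rfl⟩
  obtain ⟨χi, hχi⟩ : ∃ χi : InfinitePlace (maximalRealSubfield L) → ℤˣ, ∀ w, χi w =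
      if ideleInfiniteComponent (maximalRealSubfield L) w X ∈ quadraticNormSubgroup w.Completion
        (algebraMap (maximalRealSubfield L) w.Completion (cmQuadraticGenerator L : maximalRealSubfield L)) then 1 else -1 :=
    ⟨_, fun _ => rfl⟩
  have hθ0 : (cmQuadraticGenerator L : maximalRealSubfield L) ≠ 0 := fun h =>
    not_isSquare_cmQuadraticGenerator L (by rw [h]; exact IsSquare.zero)
  -- the `−1`-sets of `χ`
  have hχf1 : ∀ v, χf v = -1 ↔ ideleFiniteComponent (maximalRealSubfield L) v X ∉ quadraticNormSubgroup (v.adicCompletion (maximalRealSubfield L))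
      (algebraMap (maximalRealSubfield L) (v.adicCompletion (maximalRealSubfield L)) (cmQuadraticGenerator L : maximalRealSubfield L)) := by
    intro v; rw [hχf v]; split_ifs with h
    · exact ⟨fun h1 => absurd h1 (by decide), fun hn => absurd h hn⟩
    · exact ⟨fun _ => h, fun _ => rfl⟩
  have hχi1 : ∀ w, χi w = -1 ↔ ideleInfiniteComponent (maximalRealSubfield L) w X ∉ quadraticNormSubgroup w.Completion
      (algebraMap (maximalRealSubfield L) w.Completion (cmQuadraticGenerator L : maximalRealSubfield L)) := by
    intro w; rw [hχi w]; split_ifs with h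
    · exact ⟨fun h1 => absurd h1 (by decide), fun hn => absurd h hn⟩
    · exact ⟨fun _ => h, fun _ => rfl⟩
  have hAfin : {v | ideleFiniteComponent (maximalRealSubfield L) v X ∉ quadraticNormSubgroup (v.adicCompletion (maximalRealSubfield L))
      (algebraMap (maximalRealSubfield L) (v.adicCompletion (maximalRealSubfield L)) (cmQuadraticGenerator L : maximalRealSubfield L))}.Finite :=
    GaloisRepresentations.finite_setOf_ideleFiniteComponent_not_mem_quadraticNormSubgroup hθ0 X
  have hχffin : (Function.mulSupport χf).Finite := by
    rw [mulSupport_eq_setOf_eq_neg_one]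
    simp_rw [hχf1]
    exact hAfin
  -- the flips in the shape of §2
  have hflipf : ∀ v, kottwitzSignLocal L 3 H v (ConjClasses.mk ((UnitaryGroup.cmDatum L 3 H).toLocal v q.adele)) =
      kottwitzSignLocal L 3 H v (ConjClasses.mk ((UnitaryGroup.cmDatum L 3 H).toLocal v ((UnitaryGroup.cmDatum L 3 H).toAdelic γ₀))) * χf v :=
    fun v => by rw [hχf v]; exact hfin v
  have hflipi : ∀ W : {w : InfinitePlace L // IsComplex w},
      kottwitzSignAt L 3 H W (UnitaryGroup.archPart (↥(maximalRealSubfield L)) L (IsCMField.complexConj L) 3 H q.adele) =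
        kottwitzSignAt L 3 H W (UnitaryGroup.archPart (↥(maximalRealSubfield L)) L (IsCMField.complexConj L) 3 H ((UnitaryGroup.cmDatum L 3 H).toAdelic γ₀)) *
          χi (W.1.comap (algebraMap (maximalRealSubfield L) L)) :=
    fun W => by rw [hχi, archPart_cmDatum_toAdelic]; exact harch W
  rw [kottwitzSignAdelic_eq_of_flip hH hdet γ₀ hab hγ₀ hα hβ q.adele χf χi hχffin hflipf hflipi, prod_eq_neg_one_pow_ncard χi,
    finprod_eq_neg_one_pow_ncard' χf _ hAfin hχf1, ← uzpow_add, add_comm]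
  simp_rw [hχi1]

/-! ## §4 The head: A-p16 (g21)'s `SignWeightReadsObs (kottwitzSignWeight L 3 H)` modulo the local flips -/

open scoped Classical in
/-- **(d) «KOTTWITZ'S SIGN IS THE ENDOSCOPIC CHARACTER ON THE SELF-CARRIER», MODULO THE LOCAL FLIPS (3)**: given the finite-place and
complex-place flips for every rational split-singular non-central `γ₀`, matching adèle `q`, adelic conjugator `g` and descended block-determinant
idèle `W` (hypotheses `hfin`, `harch` — EXACTLY the statements of A-p17 (g16)'s `kottwitzSignLocal_toLocal_adele_eq` ∕ `kottwitzSignAt_archPart_adele_eq`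
(`KottwitzSignLocalFlip`) after their two leading binders `hH hdet`), the T1b-nonreg closer's text `SignWeightReadsObs (kottwitzSignWeight L 3 H)` (:371)
holds VERBATIM: `kottwitzSignWeight ⟦q.adele⟧ = if obs_s(q) = 0 then 1 else −1`. Proof: §3 + ★ `MatchingAdeleG₂.singularObs_eq_quadraticArtinIndicator` +
★ `quadraticArtinIndicator_eq_natCast_ncard`. [cite: Rogawski1990, §4.1 (4.1.2) pp. 39–40; §5.4 (5.4.2)–(5.4.3) pp. 72–73; §3.8 Prop. 3.8.1 (d) p. 37]
[cite: Kottwitz1983, §1] [cite: Kottwitz1986, §9] -/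
theorem kottwitzSignWeight_eq_of_singularObs_of_localFlip (hH : (H.map (cmConjRingHom L))ᵀ = H) (hdet : H.det ≠ 0)
    (hfin : ∀ {γ₀ : (UnitaryGroup.cmDatum L 3 H).Rational} {a b : L} (hab : a ≠ b), a * cmConjRingHom L a = 1 → b * cmConjRingHom L b = 1 →
      ∀ (hγ₀ : ((((γ₀ : unitaryGroup (cmConjRingHom L) H).val : GL (Fin 3) L) : Matrix (Fin 3) (Fin 3) L) - a • (1 : Matrix (Fin 3) (Fin 3) L)) *
        ((((γ₀ : unitaryGroup (cmConjRingHom L) H).val : GL (Fin 3) L) : Matrix (Fin 3) (Fin 3) L) - b • (1 : Matrix (Fin 3) (Fin 3) L)) = 0),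
      (((γ₀ : unitaryGroup (cmConjRingHom L) H).val : GL (Fin 3) L) : Matrix (Fin 3) (Fin 3) L) ≠ a • 1 →
      (((γ₀ : unitaryGroup (cmConjRingHom L) H).val : GL (Fin 3) L) : Matrix (Fin 3) (Fin 3) L) ≠ b • 1 →
      ∀ (q : MatchingAdeleG₂ L H H γ₀) {g : GL (Fin 3) (AdeleRing (𝓞 L) L)},
      g * (((UnitaryGroup.cmDatum L 3 H).toAdelic γ₀).val : GL (Fin 3) (AdeleRing (𝓞 L) L)) * g⁻¹ = (q.adele.val : GL (Fin 3) (AdeleRing (𝓞 L) L)) →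
      ∀ (W : (AdeleRing (𝓞 ↥(maximalRealSubfield L)) ↥(maximalRealSubfield L))ˣ),
      ((AdeleRing.ideleBaseChange (↥(maximalRealSubfield L)) L W : (AdeleRing (𝓞 L) L)ˣ) : AdeleRing (𝓞 L) L) = adelicBlockDet γ₀ a b g →
      ∀ v : HeightOneSpectrum (𝓞 ↥(maximalRealSubfield L)),
        kottwitzSignLocal L 3 H v (ConjClasses.mk ((UnitaryGroup.cmDatum L 3 H).toLocal v q.adele)) =
          kottwitzSignLocal L 3 H v (ConjClasses.mk ((UnitaryGroup.cmDatum L 3 H).toLocal v ((UnitaryGroup.cmDatum L 3 H).toAdelic γ₀))) *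
            (if ideleFiniteComponent (↥(maximalRealSubfield L)) v W ∈
                quadraticNormSubgroup (v.adicCompletion ↥(maximalRealSubfield L))
                  (algebraMap (↥(maximalRealSubfield L)) (v.adicCompletion ↥(maximalRealSubfield L)) (cmQuadraticGenerator L : ↥(maximalRealSubfield L)))
              then 1 else -1))
    (harch : ∀ {γ₀ : (UnitaryGroup.cmDatum L 3 H).Rational} {a b : L} (hab : a ≠ b), a * cmConjRingHom L a = 1 → b * cmConjRingHom L b = 1 →
      ∀ (hγ₀ : ((((γ₀ : unitaryGroup (cmConjRingHom L) H).val : GL (Fin 3) L) : Matrix (Fin 3) (Fin 3) L) - a • (1 : Matrix (Fin 3) (Fin 3) L)) *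
        ((((γ₀ : unitaryGroup (cmConjRingHom L) H).val : GL (Fin 3) L) : Matrix (Fin 3) (Fin 3) L) - b • (1 : Matrix (Fin 3) (Fin 3) L)) = 0),
      (((γ₀ : unitaryGroup (cmConjRingHom L) H).val : GL (Fin 3) L) : Matrix (Fin 3) (Fin 3) L) ≠ a • 1 →
      (((γ₀ : unitaryGroup (cmConjRingHom L) H).val : GL (Fin 3) L) : Matrix (Fin 3) (Fin 3) L) ≠ b • 1 →
      ∀ (q : MatchingAdeleG₂ L H H γ₀) {g : GL (Fin 3) (AdeleRing (𝓞 L) L)},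
      g * (((UnitaryGroup.cmDatum L 3 H).toAdelic γ₀).val : GL (Fin 3) (AdeleRing (𝓞 L) L)) * g⁻¹ = (q.adele.val : GL (Fin 3) (AdeleRing (𝓞 L) L)) →
      ∀ (W : (AdeleRing (𝓞 ↥(maximalRealSubfield L)) ↥(maximalRealSubfield L))ˣ),
      ((AdeleRing.ideleBaseChange (↥(maximalRealSubfield L)) L W : (AdeleRing (𝓞 L) L)ˣ) : AdeleRing (𝓞 L) L) = adelicBlockDet γ₀ a b g →
      ∀ w : {w : InfinitePlace L // IsComplex w},
        kottwitzSignAt L 3 H w (UnitaryGroup.archPart (↥(maximalRealSubfield L)) L (IsCMField.complexConj L) 3 H q.adele) =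
          kottwitzSignAt L 3 H w (cmRationalToArch L 3 H γ₀) *
            (if ideleInfiniteComponent (↥(maximalRealSubfield L)) (w.1.comap (algebraMap (↥(maximalRealSubfield L)) L)) W ∈
                quadraticNormSubgroup ((w.1.comap (algebraMap (↥(maximalRealSubfield L)) L)).Completion)
                  (algebraMap (↥(maximalRealSubfield L)) _ (cmQuadraticGenerator L : ↥(maximalRealSubfield L)))
              then 1 else -1)) :
    ∀ (γ₀ : (UnitaryGroup.cmDatum L 3 H).Rational) (a b : L) (hab : a ≠ b), cmConjRingHom L a * a = 1 → cmConjRingHom L b * b = 1 →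
    ∀ (hγ₀ : (((γ₀.val : GL (Fin 3) L) : Matrix (Fin 3) (Fin 3) L) - a • (1 : Matrix (Fin 3) (Fin 3) L)) *
      (((γ₀.val : GL (Fin 3) L) : Matrix (Fin 3) (Fin 3) L) - b • (1 : Matrix (Fin 3) (Fin 3) L)) = 0),
    (¬ ∃ ζ : L, ((γ₀.val : GL (Fin 3) L) : Matrix (Fin 3) (Fin 3) L) = ζ • (1 : Matrix (Fin 3) (Fin 3) L)) →
    ∀ q : MatchingAdeleG₂ L H H γ₀,
      kottwitzSignWeight L 3 H (ConjClasses.mk q.adele) = if q.singularObs hab hγ₀ = 0 then 1 else -1 := by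
  intro γ₀ a b hab ha hb hγ₀ hnc q
  have hHd : IsUnit H.det := isUnit_iff_ne_zero.2 hdet
  have ha' : a * cmConjRingHom L a = 1 := by rw [mul_comm]; exact ha
  have hb' : b * cmConjRingHom L b = 1 := by rw [mul_comm]; exact hb
  have hα : (((γ₀ : unitaryGroup (cmConjRingHom L) H).val : GL (Fin 3) L) : Matrix (Fin 3) (Fin 3) L) ≠ a • 1 := fun h => hnc ⟨a, h⟩
  have hβ : (((γ₀ : unitaryGroup (cmConjRingHom L) H).val : GL (Fin 3) L) : Matrix (Fin 3) (Fin 3) L) ≠ b • 1 := fun h => hnc ⟨b, h⟩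
  obtain ⟨g, hg⟩ := MatchingAdeleG₂.exists_gl_conj_eq_adele_of_mul_sub_eq_zero hab hγ₀ q
  obtain ⟨W, hW⟩ := exists_ideleBaseChange_eq_adelicBlockDet hH hHd hab ha' hb' hγ₀ q hg
  rw [kottwitzSignWeight_mk, kottwitzSignAdelic_adele_eq_of_localFlip hH hdet γ₀ hab hγ₀ hα hβ q W
      (hfin hab ha' hb' hγ₀ hα hβ q hg W hW) (harch hab ha' hb' hγ₀ hα hβ q hg W hW),
    q.singularObs_eq_quadraticArtinIndicator hHd hab ha' hb' hγ₀ hg W hW,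
    GaloisRepresentations.quadraticArtinIndicator_eq_natCast_ncard (not_isSquare_cmQuadraticGenerator L) W, neg_one_uzpow_eq_ite]
  generalize ({v : HeightOneSpectrum (𝓞 ↥(maximalRealSubfield L)) | _}.ncard + {w : InfinitePlace (maximalRealSubfield L) | _}.ncard : ℕ) = n
  by_cases h : Even n
  · rw [if_pos h, if_pos ((ZMod.natCast_eq_zero_iff_even).2 h)]; simp
  · rw [if_neg h, if_neg (fun h' => h ((ZMod.natCast_eq_zero_iff_even).1 h'))]; simp

end Literature.NumberTheory.Rogawski1990

end
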